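import Mathlib
import Summits.CriticalPhenomena.CardyFormulaZ2.Theses.CardySelfRefinement
import Literature.Probability.Percolation.PivotalCell
import Literature.Probability.Percolation.FourArmGarbanShift
import HarnessLib

/-!
# Vocabulary of route `CardySelfRefinement` (sub-problem `CriticalPhenomena/CardyFormulaZ2`)

The route items `TrivialSectorRate`, `CriticalPathRSW`, `GradientComparability`, `RussoDrift`,
`ExactEndpoints`, `LagsToInvariance` of
`Summits/CriticalPhenomena/CardyFormulaZ2/Theses/CardySelfRefinement.lean` all inline ONE model as a
`let`-chain: the self-refinement bond model `M_k(ρ,c)` on `ℤ²` (`k = 2, 3`): every fine edge lying on a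
line of the coarse lattice `kℤ²` ("axial", `ax`) reads, through a selector coin of bias `ρ`, either
the shared fair coin of its coarse edge or its own fair coin; every other fine edge is open with
probability `c`; `M_k(ρ,c)` is the push-forward of the product coin measure `prodBernoulli (prm k ρ c)`
under the read-out `cfg k`.  `P k m F η ρ c` is the `M_k(ρ,c)`-probability that the `m` quads `F i`
are all crossed (Schramm–Smirnov `configOf`, mesh `η`), `Dρ`, `Dc` its one-sided partial derivatives
(`derivWithin` on `[0,1]`), and `PathOK k γ` the admissibility of a parameter path
(continuous, `(1,0) → (0,½)`, inside `[0,1]²`, BV coordinates, two-sided box-crossing bounds uniform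
along the path).

This file is the DEFINITIONS MODULE shared by the prover files of the route
(`Theorems/CardySelfRefinement<Decl>*.lean`): it names each piece of the `let`-chain by an `abbrev`
whose body is the route's text verbatim, so that every route item is *definitionally* (`Iff.rfl`)
its readable form — the bridge theorems `trivialSectorRate_iff`, `criticalPathRSW_iff`,
`gradientComparability_iff`, `russoDrift_iff`, `exactEndpoints_iff`, `lagsToInvariance_iff` below —
and it fixes the localisation vocabulary (`nnSupport`, `window`, `Aloc`, `coinWindow`, …) used to
show that `P` is the probability of a finite cylinder, hence a polynomial in the coin biases.
Nothing is asserted here.  (`ax` must stay reducible: the route's `if ax k e then …` is decided by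
`Int.decidableDvd`.)  The same abbreviations are used, with the same bodies, in the disproof work
file `Cruxes/GradientComparability/Disproof.lean` (refuter, gen 2), from which they are adapted.
-/

noncomputable section

namespace Summit.CriticalPhenomena.CardyFormulaZ2.Theorems.CardySelfRefinement

open scoped Topology
open Filter Set MeasureTheory
open Literature.Probability.LatticeModels Literature.Probability.Percolation
open Literature.Probability.Percolation.QuadCrossing
open Summit.CriticalPhenomena.CardyFormulaZ2.Theses.CardySelfRefinement

-- adapted from Cruxes/GradientComparability/Disproof.lean §1 (refuter-cdisprove, gen 2)
/-- Axial fine edge: the edge `(v,d)` (from `v` in direction `d`) lies on a line of the coarse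
lattice `kℤ²` (horizontal edges on rows `k ∣ y`, vertical edges on columns `k ∣ x`).  Must stay an
`abbrev` (the route's `if ax k e` is decided by `Int.decidableDvd`). -/
abbrev ax (k : ℕ) (e : Site 2 × Fin 2) : Prop := (k : ℤ) ∣ e.1 (if e.2 = 0 then 1 else 0)

/-- Coarse base vertex of the fine edge `(v,d)`: floor division of both coordinates by `k`
(`Int` division is `ediv`); the `k` collinear sub-edges of a coarse edge share it. -/
abbrev tb (k : ℕ) (e : Site 2 × Fin 2) : Site 2 := fun i => e.1 i / (k : ℤ)

/-- Read-out of the fine edge `(v,d)` from the coin set `S`: an axial edge is open iff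
(selector coin on AND shared coin of its coarse edge on) OR (selector off AND own coin on); a
non-axial edge is open iff its own coin is on. -/
abbrev opn (k : ℕ) (S : Set (Site 2 × Fin 2 × Fin 3)) (e : Site 2 × Fin 2) : Prop :=
  if ax k e then ((tb k e, e.2, (2 : Fin 3)) ∈ S ∧ (tb k e, e.2, (1 : Fin 3)) ∈ S) ∨
    ((tb k e, e.2, (2 : Fin 3)) ∉ S ∧ (e.1, e.2, (0 : Fin 3)) ∈ S)
  else (e.1, e.2, (0 : Fin 3)) ∈ S

/-- Coins `↦` bond configuration of `ℤ²` (only nearest-neighbour edges are ever open). -/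
abbrev cfg (k : ℕ) (S : Set (Site 2 × Fin 2 × Fin 3)) : BondConfig (Site 2) :=
  {e | ∃ (v : Site 2) (d : Fin 2), e = s(v, v + (if d = 0 then ![1, 0] else ![0, 1])) ∧ opn k S (v, d)}

/-- Coin biases: own coin (`j = 0`: fair if axial, `c` otherwise), shared coin (`j = 1`: fair),
selector (`j = 2`: `ρ`); real parameters are clamped to `[0,1]` by `Set.projIcc`. -/
abbrev prm (k : ℕ) (ρ c : ℝ) (i : Site 2 × Fin 2 × Fin 3) : unitInterval :=
  if i.2.2 = 0 then (if ax k (i.1, i.2.1) then half else Set.projIcc (0 : ℝ) 1 zero_le_one c)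
  else if i.2.2 = 1 then half else Set.projIcc (0 : ℝ) 1 zero_le_one ρ

/-- The law `M_k(ρ,c)` on bond configurations of `ℤ²`: push-forward of the product coin measure. -/
abbrev M (k : ℕ) (ρ c : ℝ) : Measure (BondConfig (Site 2)) := (prodBernoulli (prm k ρ c)).map (cfg k)

/-- Joint crossing event of the quad family `F` at mesh `η` (Schramm–Smirnov `configOf`, positions
`squareLatticeEmbedding.z`, whole plane). -/
abbrev A (m : ℕ) (F : Fin m → Quad (Set.univ : Set ℂ)) (η : ℝ) : Set (BondConfig (Site 2)) :=
  {ω | ∀ i, F i ∈ configOf squareLatticeEmbedding.z η Set.univ ω}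

/-- Joint crossing probability `P = M_k(ρ,c)(A)`. -/
abbrev P (k m : ℕ) (F : Fin m → Quad (Set.univ : Set ℂ)) (η ρ c : ℝ) : ℝ := (M k ρ c).real (A m F η)

/-- Russo derivative in `ρ` (one-sided, within `[0,1]`) at the parameter point `q = (ρ, c)`. -/
abbrev Dρ (k m : ℕ) (F : Fin m → Quad (Set.univ : Set ℂ)) (η : ℝ) (q : ℝ × ℝ) : ℝ :=
  derivWithin (fun ρ' => P k m F η ρ' q.2) (Set.Icc 0 1) q.1

/-- Russo derivative in `c` (one-sided, within `[0,1]`) at the parameter point `q = (ρ, c)`. -/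
abbrev Dc (k m : ℕ) (F : Fin m → Quad (Set.univ : Set ℂ)) (η : ℝ) (q : ℝ × ℝ) : ℝ :=
  derivWithin (fun c' => P k m F η q.1 c') (Set.Icc 0 1) q.2

/-- Admissible (RSW) parameter paths: continuous, from `(1,0)` to `(0,½)`, inside the unit square,
both coordinates of bounded variation, two-sided box-crossing bounds uniform in the path parameter
for every aspect ratio. -/
def PathOK (k : ℕ) (γ : unitInterval → ℝ × ℝ) : Prop :=
  Continuous γ ∧ γ 0 = (1, 0) ∧ γ 1 = (0, 1 / 2) ∧ (∀ s, γ s ∈ Set.Icc (0 : ℝ) 1 ×ˢ Set.Icc (0 : ℝ) 1) ∧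
    BoundedVariationOn (fun s => (γ s).1) Set.univ ∧ BoundedVariationOn (fun s => (γ s).2) Set.univ ∧
    ∀ a : ℝ, 0 < a → ∃ c₀ > 0, ∃ n₀ : ℕ, ∀ s,
      BoxCrossingBounds (M k (γ s).1 (γ s).2) squareLatticeEmbedding.z a c₀ n₀

/-! ## Localisation vocabulary

The law `M_k(ρ,c)` lives on nearest-neighbour configurations (`nnSupport`), and there the crossing
of a quad `Q` (in the closure sense of `configOf`) is decided by the finitely many edges drawn
through the `1`-thickening of `[Q]`; `Aloc` is the resulting finite-dimensional cylinder version of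
the joint crossing event `A`, and `coinWindow` the finite set of coins it reads through `cfg`
(each fine edge reads at most the three coins `coinsOf`).  (Adapted from
`Cruxes/GradientComparability/Disproof.lean` §5c–§5e.) -/

/-- Configurations using nearest-neighbour edges of `ℤ²` only (the support of every `M_k(ρ,c)`). -/
def nnSupport : Set (BondConfig (Site 2)) := {ω | ω ⊆ (zdGraph 2).edgeSet}

/-- Pairs of sites whose drawn segment at mesh `η` meets `B`. -/
def pairsNear (η : ℝ) (B : Set ℂ) : Set (Sym2 (Site 2)) :=
  {e | ∃ x y : Site 2, e = s(x, y) ∧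
    (segment ℝ ((η : ℂ) * squareLatticeEmbedding.z x) ((η : ℂ) * squareLatticeEmbedding.z y) ∩ B).Nonempty}

/-- Nearest-neighbour edges whose drawn segment at mesh `η` meets `B`. -/
def edgesNear (η : ℝ) (B : Set ℂ) : Set (Sym2 (Site 2)) := pairsNear η B ∩ (zdGraph 2).edgeSet

/-- The finite window of nearest-neighbour edges that can matter for the family `F` at mesh `η`:
those drawn through the `1`-thickening of some carrier `[F i]`. -/
def window (m : ℕ) (F : Fin m → Quad (Set.univ : Set ℂ)) (η : ℝ) : Set (Sym2 (Site 2)) :=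
  ⋃ i, edgesNear η (Metric.thickening 1 (F i).carrier)

/-- The localised (finite-dimensional cylinder) version of the joint crossing event `A`. -/
def Aloc (m : ℕ) (F : Fin m → Quad (Set.univ : Set ℂ)) (η : ℝ) : Set (BondConfig (Site 2)) :=
  {ω | ω ∩ window m F η ∈ A m F η}

/-- The direction vector of a representative `(v,d)` of a fine edge. -/
abbrev dirVec (d : Fin 2) : Site 2 := if d = 0 then ![1, 0] else ![0, 1]

/-- The fine edge represented by `(v,d)`. -/
abbrev edgeOf (vd : Site 2 × Fin 2) : Sym2 (Site 2) := s(vd.1, vd.1 + dirVec vd.2)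

/-- The (at most three) coins read by the fine edge represented by `vd`: own, shared, selector. -/
def coinsOf (k : ℕ) (vd : Site 2 × Fin 2) : Set (Site 2 × Fin 2 × Fin 3) :=
  {(vd.1, vd.2, (0 : Fin 3)), (tb k vd, vd.2, (1 : Fin 3)), (tb k vd, vd.2, (2 : Fin 3))}

/-- The coins read by the edges of `W`. -/
def coinWindow (k : ℕ) (W : Set (Sym2 (Site 2))) : Set (Site 2 × Fin 2 × Fin 3) :=
  ⋃ vd ∈ edgeOf ⁻¹' W, coinsOf k vd

/-! ## Definitional bridges (`Iff.rfl`): the route items in readable form -/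

/-- `TrivialSectorRate` unfolded: along every RSW path and for every finite quad family the Russo
gradient is asymptotically parallel to a continuous nonvanishing `η`-independent direction field,
with absolute error `O(η^θ)`. -/
theorem trivialSectorRate_iff :
    TrivialSectorRate ↔ ∀ k : ℕ, k = 2 ∨ k = 3 → ∀ γ : unitInterval → ℝ × ℝ, PathOK k γ →
      ∀ (m : ℕ) (F : Fin m → Quad (Set.univ : Set ℂ)), ∃ θ : ℝ, 0 < θ ∧
        ∃ κ₁ κ₂ : unitInterval → ℝ, Continuous κ₁ ∧ Continuous κ₂ ∧ (∀ s, κ₁ s ≠ 0 ∨ κ₂ s ≠ 0) ∧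
          ∃ C η₀ : ℝ, 0 < η₀ ∧ ∀ s : unitInterval, ∀ η ∈ Set.Ioo 0 η₀,
            |κ₂ s * Dρ k m F η (γ s) - κ₁ s * Dc k m F η (γ s)| ≤ C * η ^ θ :=
  Iff.rfl

/-- `CriticalPathRSW` unfolded: for `k = 2, 3` an admissible RSW path exists. -/
theorem criticalPathRSW_iff :
    CriticalPathRSW ↔ ∀ k : ℕ, k = 2 ∨ k = 3 → ∃ γ : unitInterval → ℝ × ℝ, PathOK k γ :=
  Iff.rfl

/-- `GradientComparability` unfolded: comparability of the gradient size `|∂ρP| + |∂cP|` between any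
two path points at equal mesh, and its uniform divergence. -/
theorem gradientComparability_iff :
    GradientComparability ↔ ∀ k : ℕ, k = 2 ∨ k = 3 → ∀ γ : unitInterval → ℝ × ℝ, PathOK k γ →
      ∀ (m : ℕ) (F : Fin m → Quad (Set.univ : Set ℂ)), 0 < m → ∃ Λ η₀ : ℝ, 0 < η₀ ∧
        (∀ s s' : unitInterval, ∀ η ∈ Set.Ioo 0 η₀,
          |Dρ k m F η (γ s)| + |Dc k m F η (γ s)| ≤ Λ * (|Dρ k m F η (γ s')| + |Dc k m F η (γ s')|)) ∧
        ∀ N : ℝ, ∃ η₁ : ℝ, 0 < η₁ ∧ ∀ η ∈ Set.Ioo 0 η₁, ∀ s : unitInterval,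
          N ≤ |Dρ k m F η (γ s)| + |Dc k m F η (γ s)| :=
  Iff.rfl

/-- `RussoDrift` unfolded: the three engine cruxes imply the lattice lags ("for `k = 2, 3` and every
finite quad family the joint crossing probabilities under `M_k(1,0)` and `M_k(0,½)` at the same mesh
merge as `η → 0⁺`"). -/
theorem russoDrift_iff :
    RussoDrift ↔ (TrivialSectorRate → CriticalPathRSW → GradientComparability →
      ∀ k : ℕ, k = 2 ∨ k = 3 → ∀ (m : ℕ) (F : Fin m → Quad (Set.univ : Set ℂ)),
        Tendsto (fun η => P k m F η 1 0 - P k m F η 0 (1 / 2)) (𝓝[>] (0 : ℝ)) (𝓝 0)) :=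
  Iff.rfl

/-- `ExactEndpoints` unfolded: at `(1,0)` the quad-crossing law of `M_k` at mesh `η` is that of
bond-`ℤ²` at mesh `kη`, and at `(0,½)` that of bond-`ℤ²` at mesh `η`. -/
theorem exactEndpoints_iff :
    ExactEndpoints ↔ ∀ k : ℕ, k = 2 ∨ k = 3 → ∀ η : ℝ, 0 < η →
      (M k 1 0).map (configOf squareLatticeEmbedding.z η (Set.univ : Set ℂ)) =
          (bondPercolation (zdGraph 2) half).map
            (configOf squareLatticeEmbedding.z (k * η) (Set.univ : Set ℂ)) ∧
        (M k 0 (1 / 2)).map (configOf squareLatticeEmbedding.z η (Set.univ : Set ℂ)) =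
          (bondPercolation (zdGraph 2) half).map
            (configOf squareLatticeEmbedding.z η (Set.univ : Set ℂ)) :=
  Iff.rfl

/-- `LagsToInvariance` unfolded: `ExactEndpoints →` lattice lags `→` every subsequential limit is
invariant under the dilations `S_2` and `S_3`. -/
theorem lagsToInvariance_iff :
    LagsToInvariance ↔ (ExactEndpoints →
      (∀ k : ℕ, k = 2 ∨ k = 3 → ∀ (m : ℕ) (F : Fin m → Quad (Set.univ : Set ℂ)),
        Tendsto (fun η => P k m F η 1 0 - P k m F η 0 (1 / 2)) (𝓝[>] (0 : ℝ)) (𝓝 0)) →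
      ∀ μ ∈ subseqQuadLimits (Set.univ : Set ℂ),
        dilateLaw 2 two_ne_zero μ = μ ∧ dilateLaw 3 three_ne_zero μ = μ) :=
  Iff.rfl

/-! ## Vocabulary of line `far-field-is-a-quarter-turn` of the crux `TrivialSectorRate`
(stmt-CriticalPhenomena-10266)

Sub-namespace `FarField` (the registered stub signatures of the crux read these names after
`open …Theorems.CardySelfRefinement.FarField`).  Currency: COIN INFLUENCES grouped in `C₄`-orbits about
coarse vertices `u ∈ ℤ²` of `kℤ²`.  `infl` is the signed influence `P(E | i on) − P(E | i off)` of a coin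
`i` on the pulled-back localised joint crossing event `E = cfg k ⁻¹' Aloc m F η` (the coefficient of
the bias of `i` in the multilinear polynomial `P`, cf. `stub_Drho_eq_signed_sum`,
`stub_Dc_eq_sum_pivotal`); `Tρ u` / `Tc u` are the orbit-grouped responses of the four bundles at `u`
(weight `½`: a bundle has two coarse endpoints) and of the interior edges of the four cells at `u`
(weight `¼`: a cell has four corners), `Piv u` the same sums with absolute values; `bdist` is the
plane distance from the drawn block centre to the quad boundaries, `farScale = bdist / (8η)` the
far-field scale in lattice units and `wt` the layer weight; the six-arm event is rendered in the
cluster form of the tree's `fourArmTwoClustersAt` (`FourArmGarbanShift.lean`): three open crossings of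
the translated square annulus `c + A_{m,n}` pairwise NOT joined inside it (⇔ six arms of alternating
type); `Rel` is the relevance (set-pivotality, `IsPivotalOn`) of the lattice box of radius `R` about
the block centre for `Aloc`, and `Six` the six-arm SECTOR term `M_k(six arms from the ring k+1 to R ∧
R-box relevant)`.  `FourArmAboveOneAlong k γ` / `SixArmDecayAlong k γ` are the two arm-decay
PREDICATES of a parameter path (four alternating arms `≤ C (r/R)^{1+ε}`, six `≤ C (r/R)^{2+ε}`,
uniformly along the path), the hypotheses of the mass stubs of the line.  Nothing is asserted. -/

namespace FarField

/-- Coin indices of the self-refinement model: `(site, direction, layer)`, layer `0` = own coin of the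
fine edge, `1` = shared coin of a bundle (coarse edge), `2` = selector of a bundle. -/
abbrev Coin : Type := Site 2 × Fin 2 × Fin 3

/-- The localised joint crossing event of the quad family `F` at mesh `η`, pulled back to the coin
space through the read-out `cfg k` (a finite cylinder: `determinedBy_preimage_Aloc`). -/
abbrev coinEvent (k m : ℕ) (F : Fin m → Quad (univ : Set ℂ)) (η : ℝ) : Set (Set Coin) :=
  (cfg k) ⁻¹' Aloc m F η

/-- The coin law at the parameter point `q = (ρ, c)` (the route's `prodBernoulli (prm k ρ c)`). -/
abbrev coinLaw (k : ℕ) (q : ℝ × ℝ) : Measure (Set Coin) := prodBernoulli (prm k q.1 q.2)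

/-- **Signed influence** of the coin `i` on the localised joint crossing event at the parameter point
`q`: `P(event | i forced on) − P(event | i forced off)` under the coin law (both events ignore the
coordinate `i`; this is the coefficient of the bias of `i` in the multilinear polynomial `P`). -/
def infl (k m : ℕ) (F : Fin m → Quad (univ : Set ℂ)) (η : ℝ) (q : ℝ × ℝ) (i : Coin) : ℝ :=
  (coinLaw k q).real {S | insert i S ∈ coinEvent k m F η} -
    (coinLaw k q).real {S | S \ {i} ∈ coinEvent k m F η}

/-- Fine coordinates `k • u` of the coarse vertex `u ∈ ℤ²` of `kℤ²`. -/
def ctr (k : ℕ) (u : Site 2) : Site 2 := fun i => (k : ℤ) * u i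

/-- The four bundles (coarse edges, labelled by coarse base and direction as in `tb`) meeting the
coarse vertex `u`: east `(u,0)`, north `(u,1)`, west `(u − e₀, 0)`, south `(u − e₁, 1)` — a
`C₄(u)`-orbit. -/
def bundlesAt (u : Site 2) : Finset (Site 2 × Fin 2) :=
  {(u, 0), (u, 1), (u - Pi.single 0 1, 0), (u - Pi.single 1 1, 1)}

/-- The four coarse cells (labelled by their base = lower-left coarse corner) having `u` as a corner —
a `C₄(u)`-invariant family. -/
def cellsAt (u : Site 2) : Finset (Site 2) :=
  {u, u - Pi.single 0 1, u - Pi.single 1 1, u - Pi.single 0 1 - Pi.single 1 1}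

/-- The interior (non-axial) fine edges `(v, d)` of the coarse cell with base `t`:
`v = k•t + (i, j)`, `0 ≤ i, j < k`, not lying on a line of `kℤ²` (each interior edge of `ℤ²` lies in
exactly one cell, the one of `tb k (v,d) = t`). -/
def interiorEdges (k : ℕ) (t : Site 2) : Finset (Site 2 × Fin 2) :=
  ((Finset.univ : Finset (Fin k × Fin k × Fin 2)).image
      (fun p => ((fun i => (k : ℤ) * t i + (![((p.1 : ℕ) : ℤ), ((p.2.1 : ℕ) : ℤ)] : Site 2) i), p.2.2))).filter
    (fun e => ¬ ax k e)

/-- **Orbit-grouped tuple response** at the coarse vertex `u`: half the sum of the influences of the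
selector coins of the four bundles at `u` (each bundle has two coarse endpoints). -/
def Tρ (k m : ℕ) (F : Fin m → Quad (univ : Set ℂ)) (η : ℝ) (q : ℝ × ℝ) (u : Site 2) : ℝ :=
  (1 / 2 : ℝ) * ∑ b ∈ bundlesAt u, infl k m F η q (b.1, b.2, (2 : Fin 3))

/-- **Orbit-grouped interior response** at `u`: a quarter of the sum of the influences of the own
coins of the interior edges of the four cells around `u` (each cell has four corners). -/
def Tc (k m : ℕ) (F : Fin m → Quad (univ : Set ℂ)) (η : ℝ) (q : ℝ × ℝ) (u : Site 2) : ℝ :=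
  (1 / 4 : ℝ) * ∑ t ∈ cellsAt u, ∑ e ∈ interiorEdges k t, infl k m F η q (e.1, e.2, (0 : Fin 3))

/-- **Absolute orbit mass** at `u` (the same two sums with absolute influences): the local "number of
pivotals" carried by the block of `u`; `|Tρ u| + |Tc u| ≤ Piv u`. -/
def Piv (k m : ℕ) (F : Fin m → Quad (univ : Set ℂ)) (η : ℝ) (q : ℝ × ℝ) (u : Site 2) : ℝ :=
  (1 / 2 : ℝ) * ∑ b ∈ bundlesAt u, |infl k m F η q (b.1, b.2, (2 : Fin 3))| +
    (1 / 4 : ℝ) * ∑ t ∈ cellsAt u, ∑ e ∈ interiorEdges k t, |infl k m F η q (e.1, e.2, (0 : Fin 3))|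

/-- The union of the topological boundaries of the carriers of the quads of the family. -/
def quadBdry (m : ℕ) (F : Fin m → Quad (univ : Set ℂ)) : Set ℂ := ⋃ i, frontier (Set.range (F i))

/-- Plane distance from the drawn block centre `η · z(k•u)` to the quad boundaries (`0` if `m = 0`). -/
def bdist (k m : ℕ) (F : Fin m → Quad (univ : Set ℂ)) (η : ℝ) (u : Site 2) : ℝ :=
  Metric.infDist ((η : ℂ) * squareLatticeEmbedding.z (ctr k u)) (quadBdry m F)

/-- **The alternating six-arm event around `c`** in cluster form (the six-arm analogue of the tree's
`fourArmTwoClustersAt`): three open crossings of the translated square annulus `c + A_{m,n}` from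
`‖· − c‖_∞ = m` to `‖· − c‖_∞ = n`, pairwise NOT joined by an open path of `c + A_{m,n}` (three distinct
crossing clusters ⇔ six arms of alternating type open/dual). -/
def sixArmThreeClustersAt (c : Site 2) (m n : ℕ) : Set (BondConfig (Site 2)) :=
  {ω | ∃ x y : Fin 3 → Site 2,
    (∀ j, x j - c ∈ siteSphere m ∧ y j - c ∈ siteSphere n ∧
      ω ∈ openConnIn ((· + c) '' sqAnnulus m n) (x j) (y j)) ∧
    Pairwise fun i j => ω ∉ openConnIn ((· + c) '' sqAnnulus m n) (x i) (x j)}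

/-- The nearest-neighbour edges of `ℤ²` with both endpoints in the lattice box `c + [-R, R]²`. -/
def boxEdgesAt (c : Site 2) (R : ℕ) : Set (Sym2 (Site 2)) :=
  {e | e ∈ (zdGraph 2).edgeSet ∧ ∀ v ∈ e, v - c ∈ box 2 R}

/-- **Relevance of the `R`-box of the block of `u`**: the edge set of the lattice box of radius `R`
about the block centre `k•u` is pivotal AS A SET (`IsPivotalOn`) for the localised joint crossing
event `Aloc` — the configuration off the box lets the box decide the crossings. -/
def Rel (k m : ℕ) (F : Fin m → Quad (univ : Set ℂ)) (η : ℝ) (u : Site 2) (R : ℕ) :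
    Set (BondConfig (Site 2)) :=
  {ω | IsPivotalOn (Aloc m F η) (boxEdgesAt (ctr k u) R) ω}

/-- The six-arm SECTOR term of the block of `u` at scale `R` and parameter point `q`: six alternating
arms from the ring `‖· − k•u‖_∞ = k + 1` (just outside the block) to radius `R`, AND the `R`-box
relevant, under `M_k(q)`. -/
def Six (k m : ℕ) (F : Fin m → Quad (univ : Set ℂ)) (η : ℝ) (q : ℝ × ℝ) (u : Site 2) (R : ℕ) : ℝ :=
  (M k q.1 q.2).real (sixArmThreeClustersAt (ctr k u) (k + 1) R ∩ Rel k m F η u R)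

/-- The far-field scale of the block of `u` in lattice units: an eighth of its distance to the quad
boundaries divided by the mesh. -/
def farScale (k m : ℕ) (F : Fin m → Quad (univ : Set ℂ)) (η : ℝ) (u : Site 2) : ℝ :=
  bdist k m F η u / (8 * η)

/-- The layer weight of the block of `u` for the contact radius `r` (lattice units): `1` within plane
distance `rη` of the quad boundaries, `rη / bdist` beyond. -/
def wt (k m : ℕ) (F : Fin m → Quad (univ : Set ℂ)) (η : ℝ) (r : ℝ) (u : Site 2) : ℝ :=
  r * η / max (bdist k m F η u) (r * η)

/-- **Four alternating arms decay faster than `1/R` along the path `γ`** (`x₄ > 1`, uniformly in the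
path parameter and the centre): `∃ ε > 0, C` with `M_k(γ s)(fourArmTwoClustersAt c r R) ≤ C (r/R)^{1+ε}`
for all `s`, `c`, `1 ≤ r ≤ R`.  A predicate of `(k, γ)`; at the endpoint `(0, ½)` (bond-`ℤ²` at `½`)
it is the tree's `fourArm_bound` (Garban's multi-scale bound). -/
def FourArmAboveOneAlong (k : ℕ) (γ : unitInterval → ℝ × ℝ) : Prop :=
  ∃ ε C : ℝ, 0 < ε ∧ ∀ (s : unitInterval) (c : Site 2) (r R : ℕ), 1 ≤ r → r ≤ R →
    (M k (γ s).1 (γ s).2).real (fourArmTwoClustersAt c r R) ≤ C * ((r : ℝ) / R) ^ (1 + ε)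

/-- **Six alternating arms decay faster than `1/R²` along the path `γ`** (universal five-arm exponent
`2`, upper half, plus the price of a sixth arm; uniformly in the path parameter and the centre):
`∃ ε > 0, C` with `M_k(γ s)(sixArmThreeClustersAt c r R) ≤ C (r/R)^{2+ε}` for all `s`, `c`, `1 ≤ r ≤ R`. -/
def SixArmDecayAlong (k : ℕ) (γ : unitInterval → ℝ × ℝ) : Prop :=
  ∃ ε C : ℝ, 0 < ε ∧ ∀ (s : unitInterval) (c : Site 2) (r R : ℕ), 1 ≤ r → r ≤ R →
    (M k (γ s).1 (γ s).2).real (sixArmThreeClustersAt c r R) ≤ C * ((r : ℝ) / R) ^ (2 + ε)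

end FarField

end Summit.CriticalPhenomena.CardyFormulaZ2.Theorems.CardySelfRefinement

end
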